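import Summits.BirchSwinnertonDyer.BirchSwinnertonDyer.Theses.PAdicOrder
import Literature.NumberTheory.EllipticCurves.OrdinaryPrimesProofs

/-!
# BirchSwinnertonDyer / PAdicOrder — existence of a good ordinary prime `p ≥ 5`

Route `PAdicOrder`, support item `stmt-BirchSwinnertonDyer-0140`
(`PAdicOrderExistsOrdinary`): every elliptic curve over `ℚ`, given by a globally minimal
Weierstrass equation `W`, has a prime `p ≥ 5` of good reduction with `p ∤ a_p(W)`, i.e. a good
ordinary prime.

The route decl is verbatim the named fact `WeierstrassCurve.exists_good_ordinary_prime`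
(`Literature.NumberTheory.EllipticCurves.OrdinaryPrimes`), which is discharged in the tree by
`WeierstrassCurve.exists_good_ordinary_prime_holds`
(`Literature.NumberTheory.EllipticCurves.OrdinaryPrimesProofs`; elementary proof via primes
`p ≡ 1 (mod 4)` modulo which the 2-torsion cubic splits — the cited source, Serre 1981 §8.2
Thm 20 Cor 2, proves the much stronger density-zero statement for supersingular primes of a
non-CM curve). This file only transports that theorem to the route decl.
-/

-- single-conjunct summit: `Summit.BirchSwinnertonDyer.BirchSwinnertonDyer.…` repeats the name by design
set_option linter.dupNamespace false

namespace Summit.BirchSwinnertonDyer.BirchSwinnertonDyer.Theorems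

/-- Settles `stmt-BirchSwinnertonDyer-0140` (support of route PAdicOrder): every elliptic curve
over `ℚ` in globally minimal Weierstrass form has a good ordinary prime `p ≥ 5`
(`W.HasGoodReductionAtPrime p ∧ ¬ (p : ℤ) ∣ W.frobeniusTrace p`). Immediate from the tree theorem
`WeierstrassCurve.exists_good_ordinary_prime_holds`. [cite: Serre1981, §8.2 Thm 20 Cor 2] -/
theorem padicOrderExistsOrdinary_proof :
    Summit.BirchSwinnertonDyer.BirchSwinnertonDyer.Theses.PAdicOrder.PAdicOrderExistsOrdinary := by
  unfold Summit.BirchSwinnertonDyer.BirchSwinnertonDyer.Theses.PAdicOrder.PAdicOrderExistsOrdinary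
  intro W _ _
  exact WeierstrassCurve.exists_good_ordinary_prime_holds W

end Summit.BirchSwinnertonDyer.BirchSwinnertonDyer.Theorems
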